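import Literature.Claims.NS.Chaabani2020
import HarnessLib

/-!
# C22 `Chaabani2020` — kernel facts for the NS-claims sweep (D-0090), refuter-8

Typed record: `Literature.Claims.NS.Chaabani2020` (typist-5, p472010), A. Chaabani, arXiv:2004.06956v1
(2020), §2. The termination step l.274–282, p.8 («Repeating this process as many times as needed to
obtain [t_0,T_max) = ∪_{j=0}^{N−1}[t_j,t_{j+1}] ∪ [t_N,T_max) … In fact, on the interval [t_N,T_max)
either F_{m_N}(t) ≥ 0 holds true for all t ∈ [t_N,T_max) or F_{m_N}(t) ≤ 0 holds true for all
t ∈ [t_N,T_max)») is typed at the scalar (F15) grain as `LastIntervalSign`: the print invokes only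
continuity / smoothness of `t ↦ F_m(t)` ((2.5), l.211–215).

Kernel facts (sorry-free, standard axioms):

* `not_LastIntervalSign` — a FINITE chain of successive constant-sign intervals whose last member
  `[t_N, T)` has constant sign need not exist for continuous, smooth sign-test functions: take
  `F_m(t) = sin (1/(T − t))` for every `m` (its sign changes accumulate at `T`), any positive rule `μ`.
* `not_step5Display_printed` — the elementary display l.242–250 p.7 with the PRINTED multiplier
  `8/(c₁ν²)` (typist's `Step_5Display c₁ (printedRule c₁)`, E1; NOT consumed by the chain) fails for
  every `c₁ ≥ 1`: `ν = E = 1`, `m = 4`.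

WHAT THIS IS NOT: not a claim about NS regularity or blow-up; not a claim about any author beyond the
typed locator.
-/

set_option linter.dupNamespace false

noncomputable section

open Set
open scoped ContDiff

namespace Summit.NavierStokesRegularity.NavierStokesRegularity.Theorems.Chaabani2020

/-! ## The oscillating sign-test function -/

/-- The sign-test function `s ↦ sin (1/(T − s))`, oscillating infinitely often before `T`. -/
def osc (T : ℝ) (s : ℝ) : ℝ := Real.sin (1 / (T - s))

/-- `osc T` is continuous on `[t₀, T)`. [folklore] -/
theorem osc_continuousOn (t₀ T : ℝ) : ContinuousOn (osc T) (Ico t₀ T) := by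
  unfold osc
  apply Real.continuous_sin.comp_continuousOn
  apply ContinuousOn.div continuousOn_const (continuousOn_const.sub continuousOn_id)
  intro s hs
  exact sub_ne_zero.mpr (ne_of_gt hs.2)

/-- `osc T` is smooth on `(t₀, T)`. [folklore] -/
theorem osc_contDiffOn (t₀ T : ℝ) : ContDiffOn ℝ ∞ (osc T) (Ioo t₀ T) := by
  unfold osc
  apply Real.contDiff_sin.comp_contDiffOn
  apply ContDiffOn.div contDiffOn_const (contDiffOn_const.sub contDiffOn_id)
  intro s hs
  exact sub_ne_zero.mpr (ne_of_gt hs.2)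

/-- In every `[a, T)` with `a < T` the function `osc T` takes the value `1`
(at `s = T − 1/(π/2 + 2πn)`, `n` large). [folklore] -/
theorem osc_eq_one_near (T a : ℝ) (ha : a < T) : ∃ s ∈ Ico a T, osc T s = 1 := by
  obtain ⟨n, hn⟩ := exists_nat_gt (1 / (T - a))
  set x : ℝ := Real.pi / 2 + n * (2 * Real.pi) with hx
  have hpi := Real.pi_pos
  have hx0 : 1 / (T - a) < x := by
    have hn0 : (0 : ℝ) ≤ n := Nat.cast_nonneg n
    have : (n : ℝ) ≤ n * (2 * Real.pi) := by nlinarith [Real.pi_gt_three, hn0]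
    rw [hx]
    linarith
  have hxpos : 0 < x := by
    rw [hx]
    positivity
  refine ⟨T - 1 / x, ⟨?_, ?_⟩, ?_⟩
  · have hTa : 0 < T - a := sub_pos.mpr ha
    have : 1 / x < T - a := by
      rw [div_lt_iff₀ hxpos]
      have := (div_lt_iff₀ hTa).mp hx0
      linarith
    linarith
  · have : 0 < 1 / x := by positivity
    linarith
  · unfold osc
    rw [show T - (T - 1 / x) = 1 / x by ring, one_div_one_div, hx, Real.sin_add_nat_mul_two_pi,
      Real.sin_pi_div_two]

/-- In every `[a, T)` with `a < T` the function `osc T` takes the value `−1`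
(at `s = T − 1/(−π/2 + 2πn)`, `n` large). [folklore] -/
theorem osc_eq_neg_one_near (T a : ℝ) (ha : a < T) : ∃ s ∈ Ico a T, osc T s = -1 := by
  obtain ⟨n, hn⟩ := exists_nat_gt (1 / (T - a) + Real.pi)
  set x : ℝ := -(Real.pi / 2) + n * (2 * Real.pi) with hx
  have hpi := Real.pi_pos
  have hx0 : 1 / (T - a) < x := by
    have hn0 : (0 : ℝ) ≤ n := Nat.cast_nonneg n
    have : (n : ℝ) ≤ n * (2 * Real.pi) := by nlinarith [Real.pi_gt_three, hn0]
    rw [hx]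
    linarith
  have hTa : 0 < T - a := sub_pos.mpr ha
  have hxpos : 0 < x := lt_trans (by positivity) hx0
  refine ⟨T - 1 / x, ⟨?_, ?_⟩, ?_⟩
  · have : 1 / x < T - a := by
      rw [div_lt_iff₀ hxpos]
      have := (div_lt_iff₀ hTa).mp hx0
      linarith
    linarith
  · have : 0 < 1 / x := by positivity
    linarith
  · unfold osc
    rw [show T - (T - 1 / x) = 1 / x by ring, one_div_one_div, hx, Real.sin_add_nat_mul_two_pi,
      Real.sin_neg, Real.sin_pi_div_two]

/-! ## The termination step is false at the typed grain -/

/-- **The termination step l.274–282 p.8 fails at the scalar grain (C22).** With `t₀ = 0`, `T = 1`,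
`F_m = osc 1` for every `m` (continuous on `[0,1)`, smooth on `(0,1)`) and the rule `μ ≡ 1`, no finite
chain of successive intervals can end with a last interval `[t_N, 1)` on which `F_{m_N}` has constant
sign: `osc 1` takes both values `±1` in every `[t_N, 1)`. Refutes
`Literature.Claims.NS.Chaabani2020.LastIntervalSign` [refuted-substantive at the typed grain: the
print's only inputs, continuity/smoothness of `t ↦ F_m(t)` ((2.5)), do not bound the number of sign
changes before `T_max`; the solution-level instance `Step_6` carries the whole regularity problem].
[folklore] -/
theorem not_LastIntervalSign : ¬ Literature.Claims.NS.Chaabani2020.LastIntervalSign := by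
  intro h
  obtain ⟨N, t, -, -, htN, -, hlast⟩ :=
    h 0 1 one_pos (fun _ => osc 1) (fun _ => osc_continuousOn 0 1) (fun _ => osc_contDiffOn 0 1)
      (fun _ => 1) (fun _ => one_pos)
  rcases hlast with hge | hle
  · obtain ⟨s, hs, hval⟩ := osc_eq_neg_one_near 1 (t N) htN
    have := hge s hs
    simp only [hval] at this
    linarith
  · obtain ⟨s, hs, hval⟩ := osc_eq_one_near 1 (t N) htN
    have := hle s hs
    simp only [hval] at this
    linarith

/-! ## E1: the printed multiplier `8/(c₁ν²)` does not give the displayed positivity -/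

/-- **The display l.242–250 p.7 with the PRINTED multiplier fails (E1 erratum, C22)** for every
`c₁ > 1`: with `ν = E = 1` the printed threshold is `m > 4/c₁`, so `m = 4c₁` is admissible, and there
`2√c₁ · √E/√m = 2√c₁/(2√c₁) = 1`, not `< ν = 1`. (`Step_5Display` is not consumed by the paper's chain
`claim_of_steps`; recorded as an erratum. At `c₁ = 1` the two thresholds coincide and the display
holds.) [folklore] -/
theorem not_step5Display_printed (c₁ : ℝ) (hc : 1 < c₁) :
    ¬ Literature.Claims.NS.Chaabani2020.Step_5Display c₁
      (Literature.Claims.NS.Chaabani2020.printedRule c₁) := by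
  intro h
  have hc0 : 0 < c₁ := by linarith
  have hm : 0 < 4 * c₁ := by positivity
  have hyp : Literature.Claims.NS.Chaabani2020.printedRule c₁ 1 / 2 * 1 < 4 * c₁ := by
    unfold Literature.Claims.NS.Chaabani2020.printedRule
    have h1 : 8 / (c₁ * (1 : ℝ) ^ 2) / 2 * 1 = 4 / c₁ := by
      field_simp
      ring
    rw [h1, div_lt_iff₀ hc0]
    nlinarith
  have key := h 1 1 (4 * c₁) one_pos one_pos hm hyp
  have hs : Real.sqrt (4 * c₁) = 2 * Real.sqrt c₁ := by
    rw [Real.sqrt_mul (by norm_num : (0 : ℝ) ≤ 4),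
      show Real.sqrt 4 = 2 by rw [show (4 : ℝ) = 2 ^ 2 by norm_num, Real.sqrt_sq (by norm_num)]]
  have hpos : 0 < Real.sqrt c₁ := Real.sqrt_pos.mpr hc0
  rw [Real.sqrt_one, hs] at key
  have h1 : 2 * Real.sqrt c₁ * (1 / (2 * Real.sqrt c₁)) = 1 := by
    field_simp
  linarith

/-- **The E1-corrected display holds**: with the multiplier `8c₁/ν²` (typist's `correctedRule`, what
l.246–248 actually requires), `m > 4c₁E/ν²` gives `2√c₁ · √E/√m < ν`. [folklore] -/
theorem step5Display_corrected (c₁ : ℝ) (hc : 0 < c₁) :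
    Literature.Claims.NS.Chaabani2020.Step_5Display c₁
      (Literature.Claims.NS.Chaabani2020.correctedRule c₁) := by
  intro ν E m hν hE hm hlt
  unfold Literature.Claims.NS.Chaabani2020.correctedRule at hlt
  have h4 : 4 * c₁ * E < ν ^ 2 * m := by
    have h1 : 8 * c₁ / ν ^ 2 / 2 * E = 4 * c₁ * E / ν ^ 2 := by ring
    rw [h1, div_lt_iff₀ (by positivity)] at hlt
    linarith
  have hsm : 0 < Real.sqrt m := Real.sqrt_pos.mpr hm
  rw [mul_div_assoc', div_lt_iff₀ hsm]
  refine lt_of_pow_lt_pow_left₀ 2 (by positivity) ?_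
  rw [mul_pow, mul_pow, mul_pow, Real.sq_sqrt hc.le, Real.sq_sqrt hE.le, Real.sq_sqrt hm.le]
  linarith

end Summit.NavierStokesRegularity.NavierStokesRegularity.Theorems.Chaabani2020

end
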